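import Literature.AlgebraicGeometry.Resolution.PrincipalizationToResolution
import Literature.AlgebraicGeometry.Resolution.RegularLocusOpen
import Literature.AlgebraicGeometry.Resolution.ExcellentRingsFieldProofs
import Literature.AlgebraicGeometry.Resolution.RegularLocalRingsFlatDescent

/-!
# Flat charts by regular schemes along a fibre of a proper birational morphism resolve a neighbourhood

Crux `ProductDescent` (stmt-ResolutionOfSingularities-15231), line `vertical-lines`, stub
`stub_resolutionOfFlatCharts`.

Setting: `X` locally of finite type over `𝔽_p = ZMod p`, `x ∈ X`, `g : U' → X` proper and
birational, and every point `u'` of the fibre `g⁻¹(x)` is the image `a(v)` of a point `v` with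
regular local ring `𝒪_{V,v}` under a flat morphism `a : V → U'`. Conclusion: some open `U₁ ∋ x`
of `X` has a resolution of singularities.

Proof.
* `U'` is locally of finite type over `𝔽_p` (`g ≫ f`), hence locally Noetherian, so its stalks
  are Noetherian local rings; the stalk map of `a` at `v` is a flat local homomorphism
  `𝒪_{U',u'} → 𝒪_{V,v}` into a regular local ring, so `𝒪_{U',u'}` is regular (Matsumura,
  Thm. 23.7 (i), in tree: `IsRegularLocalRing.of_flat_ringHom`). Thus `g⁻¹(x) ⊆ Reg U'`.
* `Reg U'` is open (`isOpen_regularLocus_of_locallyOfFiniteType` over the quasi-excellent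
  `Spec 𝔽_p`, `Stacks07QW_field_holds`), so `S = U' ∖ Reg U'` is closed, and `g(S)` is closed
  (`g` is universally closed) and misses `x`.
* Over `U₁ = X ∖ g(S) ∋ x` the restriction `g ∣_ U₁ : g⁻¹(U₁) → U₁` is proper, birational
  (`IsBirational.morphismRestrict`), and its source is regular: the points of `g⁻¹(U₁)` lie in
  `Reg U'` and the stalks of the open subscheme are those of `U'`.
-/

noncomputable section

set_option linter.dupNamespace false

open CategoryTheory CategoryTheory.Limits AlgebraicGeometry Literature.AlgebraicGeometry.Resolution

namespace Summit.ResolutionOfSingularities.ResolutionOfSingularities.Theorems.ProductDescent.VerticalLines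

/-- **Flat descent of regularity at a point** (Matsumura, Thm. 23.7 (i), scheme form): if
`a : V → U'` is flat, `U'` is locally Noetherian and `𝒪_{V,v}` is a regular local ring, then
`𝒪_{U',a(v)}` is a regular local ring — the stalk map `𝒪_{U',a(v)} → 𝒪_{V,v}` is a flat local
homomorphism of Noetherian local rings. [cite: Matsumura1987, Thm. 23.7 (i)] -/
theorem flatCharts_isRegularLocalRing_stalk {V U' : Scheme.{0}} (a : V ⟶ U') [Flat a]
    [IsLocallyNoetherian U'] (v : V) [IsRegularLocalRing (V.presheaf.stalk v)] :
    IsRegularLocalRing (U'.presheaf.stalk (a.base v)) :=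
  IsRegularLocalRing.of_flat_ringHom (a.stalkMap v).hom (Flat.stalkMap a v)

/-- The fibre of `g` over `x` lies in the regular locus of `U'` as soon as each of its points is
the image of a regular-stalk point under a flat morphism (`U'` locally Noetherian).
[cite: Matsumura1987, Thm. 23.7 (i)] -/
theorem flatCharts_fibre_subset_regularLocus {U' X : Scheme.{0}} (g : U' ⟶ X)
    [IsLocallyNoetherian U'] (x : X)
    (hcharts : ∀ u' : U', g.base u' = x → ∃ (V : Scheme.{0}) (a : V ⟶ U') (v : V),
      Flat a ∧ a.base v = u' ∧ IsRegularLocalRing (V.presheaf.stalk v)) :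
    ∀ u' : U', g.base u' = x → u' ∈ Scheme.regularLocus U' := by
  intro u' hu'
  obtain ⟨V, a, v, ha, hav, hv⟩ := hcharts u' hu'
  subst hav
  exact flatCharts_isRegularLocalRing_stalk a v

/-- **Restricting a proper birational morphism with regular-locus control gives a resolution.**
If `g : U' → X` is proper birational, `Reg U'` is open, and `U₁ ⊆ X` is an open all of whose
`g`-preimage lies in `Reg U'`, then `g ∣_ U₁` is a resolution of `U₁`. [folklore] -/
theorem flatCharts_isResolution_morphismRestrict {U' X : Scheme.{0}} (g : U' ⟶ X) [IsProper g]
    (hb : IsBirational g) (U₁ : X.Opens)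
    (hU₁ : ∀ u' : U', g.base u' ∈ U₁ → u' ∈ Scheme.regularLocus U') :
    IsResolution (g ∣_ U₁) := by
  refine ⟨inferInstance, hb.morphismRestrict U₁, ?_⟩
  intro z
  have hz : (g ⁻¹ᵁ U₁).ι.base z ∈ Scheme.regularLocus U' := hU₁ _ z.2
  have hreg : IsRegularLocalRing (U'.presheaf.stalk ((g ⁻¹ᵁ U₁).ι.base z)) := hz
  exact IsRegularLocalRing.of_ringEquiv (asIso ((g ⁻¹ᵁ U₁).ι.stalkMap z)).commRingCatIsoToRingEquiv

/-- **Flat charts by regular schemes along a fibre of a proper birational morphism give a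
resolution of a neighbourhood.** `X` locally of finite type over `𝔽_p`, `g : U' → X` proper
birational; if every `u' ∈ g⁻¹(x)` is `a(v)` for a morphism `a : V → U'` flat (on `V`) with
`𝒪_{V,v}` regular, then `𝒪_{U',u'}` is regular (Matsumura 23.7 (i):
`IsRegularLocalRing.of_flat_ringHom` with `Flat.stalkMap`; stalks of `U'` are Noetherian), the
regular locus of `U'` is open (`isOpen_regularLocus_of_locallyOfFiniteType`, `Spec 𝔽_p`
quasi-excellent), its complement has closed image not containing `x` (`g` universally closed),
and over the complementary open `U₁ ∋ x` the restriction `g ∣_ U₁` is proper, birational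
(`IsBirational.morphismRestrict`) with regular source. [cite: Matsumura1987, Thm. 23.7 (i)] -/
theorem stub_resolutionOfFlatCharts :
    ∀ p : ℕ, p.Prime → ∀ (X : Scheme.{0}) (f : X ⟶ Spec (.of (ZMod p))),
      LocallyOfFiniteType f → ∀ (x : X) (U' : Scheme.{0}) (g : U' ⟶ X),
      IsProper g → IsBirational g →
      (∀ u' : U', g.base u' = x → ∃ (V : Scheme.{0}) (a : V ⟶ U') (v : V),
          Flat a ∧ a.base v = u' ∧ IsRegularLocalRing (V.presheaf.stalk v)) →
      ∃ U₁ : X.Opens, x ∈ U₁ ∧ Scheme.HasResolution (U₁ : Scheme.{0}) := by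
  intro p hp X f hf x U' g hg hb hcharts
  haveI : Fact p.Prime := ⟨hp⟩
  -- `U'` is locally of finite type over `𝔽_p`, hence locally Noetherian
  haveI : IsLocallyNoetherian U' := LocallyOfFiniteType.isLocallyNoetherian (g ≫ f)
  -- the regular locus of `U'` is open (`Spec 𝔽_p` is quasi-excellent)
  have hk : Scheme.IsQuasiExcellent (Spec (.of (ZMod p))) :=
    Scheme.isQuasiExcellent_of_locallyOfFiniteType Stacks07QW_field_holds (𝟙 (Spec (.of (ZMod p))))
  have hopen : IsOpen (Scheme.regularLocus U') :=
    isOpen_regularLocus_of_locallyOfFiniteType (g ≫ f) hk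
  -- the fibre over `x` lies in the regular locus (flat descent of regularity)
  have hfib := flatCharts_fibre_subset_regularLocus g x hcharts
  -- the image of the singular locus is closed and misses `x`
  have hgS : IsClosed (g.base '' (Scheme.regularLocus U')ᶜ) :=
    g.isClosedMap _ hopen.isClosed_compl
  let U₁ : X.Opens := ⟨(g.base '' (Scheme.regularLocus U')ᶜ)ᶜ, hgS.isOpen_compl⟩
  have hxU₁ : x ∈ U₁ := by
    rintro ⟨u', hu'S, hu'x⟩
    exact hu'S (hfib u' hu'x)
  have hU₁ : ∀ u' : U', g.base u' ∈ U₁ → u' ∈ Scheme.regularLocus U' := by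
    intro u' hu'
    by_contra h
    exact hu' ⟨u', h, rfl⟩
  exact ⟨U₁, hxU₁, _, g ∣_ U₁, flatCharts_isResolution_morphismRestrict g hb U₁ hU₁⟩

end Summit.ResolutionOfSingularities.ResolutionOfSingularities.Theorems.ProductDescent.VerticalLines

end
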